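import Summits.QuantumFields.YangMills.Theorems.FluctuationComparisonRegPrIntLLargeFieldGasSocketOfEngine
import HarnessLib

/-!
# THE BARE KNIT AND THE BARE SOCKET OF THE LF LANE (G18, px10 lineage, FILE K): ✓KnitAE §3 and ✓`…SocketOfEngine` WITHOUT THE CONTINUITY ROW — the ∃-body of
# ⟨LFG^{ae,bare}∘⟩ (Kotecký–Preiss block ∧ the gas identity `dU_J`-A.E. between the honest densities) from the 𝐑-operation's output rows minus `hζc`

Cell `ym3-torus` (HUMAN RULING D-0037: rung R3 = continuum `SU(2)` Yang–Mills on `T³` — NOT `d = 4`, NOT infinite volume, NOT a mass gap, NOT the Clay problem); width seat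
`ym3-torus-px10` (gen 19); helper of the crux `stmt-QuantumFields-20520` `UnitScaleTilt.FluctuationComparisonRegPrIntL` (`--supports … --as helper`, NOT a proof of it).
THEOREMS ONLY: 0 `def`, 0 `instance`, 0 `notation`, 0 `sorry`, default heartbeats.

WHY.  ✓FILE J `…LargeFieldGasFourPtOfAEIdentity.largeFieldFourPtIntCan_of_aeIntBare` derives the registered `LargeFieldFourPtIntCan` from ⟨LFG^{ae,bare}∘⟩ — ✓FILE 4's
⟨LFG^{ae}∘⟩ with its continuity row deleted.  Upstream, the typed chain (✓KnitAE `aeGas_of_factorised_histories` ∕ `canIntBody_of_factorised_histories`,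
✓`…SocketOfEngine.canIntBody_of_engine`, ✓FILE 10, ✓FILE C∕E∕I) still CARRIES continuity rows, consumed only to emit continuity rows and, at the very end, by ✓FILE 4's
canonical transfer — which FILE J bypasses.  THIS FILE strikes the row from the two innermost links, re-using the landed proofs: the generic knit
✓`aeGas_of_factorised_histories` is stated for an ARBITRARY topology on the group, so it is read here at the DISCRETE topology on `SU(2)` (`letI … := ⊥`), where its
continuity input is vacuous (`continuous_of_discreteTopology`) and its continuity output is dropped; nothing else in it sees the topology.
* §1 ★★`aeIntBareBody_of_factorised_histories` — ✓KnitAE §3's hypotheses minus (r1∘) and minus `hζc` ⟹ `∃ cst w, (KP block) ∧ ∀ᵐ U ∂dU_J, U ∈ W_J^{c} →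
  heightDensity univ U = e^{cst}·heightDensity histGood U·Re Ξ(w_U)`.
* §2 ★★★`aeIntBareBody_of_engineBare` — ✓`canIntBody_of_engine`'s hypotheses minus (r1∘) and minus `hζc` (the BARE ENGINE ROWS: footprint map `Adm`, the a.e. ratio
  identities `hrat` per deep history, V-locality `hloc`, majorant `hdom`∕`hζ0`, energy `hζ`, located budget `hbud`, rate `hμ`) ⟹ the same ∃-body; proof = the landed
  socket proof verbatim (FILE 7 geometry, FILE 8 budget, (H+W) ✓`heightDensity_univ_ae_eq_sum_deep_on_window`, off-deep vanishing ✓`ratio_eq_zero_of_not_deep`) ending in §1.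
The prefix threading (✓FILE 10's shape) and the two-gas edition follow in FILES L∕M.

HONEST — WHAT THIS IS NOT.  Re-threading of landed measure theory∕combinatorics; nothing of Bałaban's analysis; the bare engine rows ARE the 𝐑-operation's output (XL, OPEN).
`h2P`∕`h2W`, LF-INT∘, `stub_largeFieldFourPtIntCan`, S2β, the crux 20520 NOT proved; `YM3TorusSU2` NOT proved; finite volume ∕ conditional; the Yang–Mills mass gap (Clay) NOT
proved; rung R3 = YM₃ on `T³` — NOT `d = 4`, NOT infinite volume, NOT a mass gap.
References: [Balaban1985UV3] CMP 102 (1985) (39)–(41) p.266, (43)–(47) pp.266–267, (67)–(71) pp.273–274; [Balaban1989LargeFieldII] CMP 122 (1989) (1.84) p.386, (1.90)–(1.91)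
p.388, (1.97)–(1.101) pp.389–390; [Balaban1987RG1] CMP 109 (1987) (0.13) p.254; [KoteckyPreiss1986] CMP 103 (1986) Theorem p.492 (1).
-/

set_option autoImplicit false

noncomputable section

open Finset MeasureTheory Filter Topology Set
open scoped BigOperators
open Literature.Probability.LatticeModels
open Literature.MathematicalPhysics.QuantumFieldTheory.Balaban1983to89
open Literature.MathematicalPhysics.QuantumFieldTheory.Balaban1983to89.T3ContinuumYM3Torus
open Literature.MathematicalPhysics.QuantumFieldTheory.Balaban1983to89.T3NestedUnitLaws
open Literature.MathematicalPhysics.QuantumFieldTheory.Balaban1983to89.T3UnitLawDensityEML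
open Literature.MathematicalPhysics.QuantumFieldTheory.Balaban1983to89.T3UnitScaleTilt
open Literature.MathematicalPhysics.QuantumFieldTheory.Balaban1983to89.T3TiltDescent
open Literature.MathematicalPhysics.QuantumFieldTheory.Balaban1983to89.T3PrintedRegularMinimiser
open Literature.MathematicalPhysics.QuantumFieldTheory.Balaban1983to89.T3LevelShift
open Literature.MathematicalPhysics.QuantumFieldTheory.Balaban1983to89.Missing
open Literature.MathematicalPhysics.QuantumFieldTheory.Balaban1983to89.T4Continuum
open scoped Literature.MathematicalPhysics.QuantumFieldTheory.Balaban1983to89.T3OrbitAverage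
open Literature.MathematicalPhysics.QuantumFieldTheory.Balaban1983to89.Node00 (touchingGraph SiteTouch degree_touchingGraph_siteTouch_le_pred)
open Literature.MathematicalPhysics.QuantumFieldTheory.BalabanImbrieJaffe1984to88.BIJ85BlockAveragesTorusK (blkIter)
open Summit.QuantumFields.YangMills.Theorems.FluctuationComparisonRegPrIntLWregGlue (heightDensityCan)
open Summit.QuantumFields.YangMills.Theorems.FluctuationComparisonRegPrIntLHistoryPartition (LFLabel histEvent smallFactor smallFactor_pos)
open Summit.QuantumFields.YangMills.Theorems.FluctuationComparisonRegPrIntLLargeFieldGasKnitAE (ratio_eq_zero_of_not_deep aeGas_of_factorised_histories)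
open Summit.QuantumFields.YangMills.Theorems.FluctuationComparisonRegPrIntLLargeFieldGasWindowCut (heightDensity_univ_ae_eq_sum_deep_on_window)
open Literature.MathematicalPhysics.QuantumFieldTheory.Balaban1983to89.B5Eq118OneStroke (iterBlockOf)
open Summit.QuantumFields.YangMills.Theorems.FluctuationComparisonRegPrIntLLargeFieldGasFootprint (mem_biUnion_cell_iff card_image_blk_biUnion_cell
  supDiam_le_of_adm footprint_hdiam card_filter_mem_cell_le_one card_cell_le one_le_three_pow_sub_one)

namespace Summit.QuantumFields.YangMills.Theorems.FluctuationComparisonRegPrIntLLargeFieldGasBareKnit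

/-! ## §1 The bare knit -/

open Classical in
/-- ★★ **THE BARE A.E. ∃-BODY FROM FACTORISED HISTORIES** — ✓KnitAE `canIntBody_of_factorised_histories` WITHOUT (r1∘) and WITHOUT the continuity row `hζc`, concluding the
∃-body of ⟨LFG^{ae,bare}∘⟩ (the KP block ∧ the gas identity `dU_J`-A.E. between the HONEST densities): ✓`aeGas_of_factorised_histories` read at the DISCRETE topology on
`SU(2)` (its continuity input feeds only its continuity output, which is dropped — both vacuous there), no canonical transfer.
[cite: Balaban1989LargeFieldII, (1.90)-(1.91) p.388 and (1.97)-(1.101) pp.389-390; Balaban1985UV3, (41) p.266 and (67)-(71) pp.273-274] -/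
theorem aeIntBareBody_of_factorised_histories (F : T3Family) {γ : ℝ} (b₀ p₀ c : ℝ) {J K : ℕ} (hJK : J ≤ K) {κ : ℝ} (hκ : 0 ≤ κ) (Ψ : ℕ → ℝ)
    -- footprint geometry on the height-`J` bonds
    {C : Type*} [Fintype C] [DecidableEq C] (H : SimpleGraph C) [DecidableRel H.Adj] {Δ : ℕ} (hΔ : ∀ cc, H.degree cc ≤ Δ) (h1Δ : 1 ≤ Δ)
    (cell : C → Finset (PBond (F.P J) 0)) {m s₀ : ℕ}
    (hm : ∀ e : PBond (F.P J) 0, (Finset.univ.filter fun cc : C => e ∈ cell cc).card ≤ m) (h1m : 1 ≤ m)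
    (hs₀ : ∀ cc, (cell cc).card ≤ s₀) (size : Finset (PBond (F.P J) 0) → ℕ)
    (ℓ : Finset (PBond (F.P J) 0) → ℝ) (ℓ₀ : ℝ) (hℓ0 : ∀ X, 0 ≤ ℓ X)
    (hdiam : ∀ X : Finset (PBond (F.P J) 0), ∀ e ∈ X, ∀ e' ∈ X, (e.src.tdist e'.src : ℝ) ≤ ℓ X)
    -- the expansion data
    {Λ : Type*} [Fintype Λ] [DecidableEq Λ] (π : Λ → PBond (F.P J) 0) (Adm : Finset Λ → Finset (PBond (F.P J) 0) → Prop)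
    (ζ : Finset Λ → Finset (PBond (F.P J) 0) → GaugeField (F.P J) 0 (Matrix.specialUnitaryGroup (Fin 2) ℂ) → ℝ)
    (ζbar : Finset Λ → Finset (PBond (F.P J) 0) → ℝ) (sf : Λ → ℝ) (κmu : ℝ)
    (D : Finset (Finset Λ)) (g r : Finset Λ → GaugeField (F.P J) 0 (Matrix.specialUnitaryGroup (Fin 2) ℂ) → ℝ)
    (hAdm : ∀ Q' X, Adm Q' X → Q'.Nonempty ∧ (∀ l ∈ Q', π l ∈ X) ∧
      ∃ Fc : Finset C, (H.induce (Fc : Set C)).Connected ∧ Fc.biUnion cell = X ∧ Fc.card = size X)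
    (hℓ : ∀ X, (∃ Q', Adm Q' X) → ℓ X ≤ ℓ₀ * (size X : ℝ))
    -- the socket: (H+W) a.e., the a.e. ratio identities on the deep histories, the continuous factorised expansion, energy, budget
    (hsum : ∀ᵐ U ∂fieldMeasure (F.P J) 0 (Matrix.specialUnitaryGroup (Fin 2) ℂ), PlaqSmall (θBal F.L γ (c * b₀) p₀ J) U →
      heightDensity F γ hJK Set.univ U = ∑ Q ∈ D, g Q U)
    (hrat : ∀ Q ∈ D, ∀ᵐ U ∂fieldMeasure (F.P J) 0 (Matrix.specialUnitaryGroup (Fin 2) ℂ), PlaqSmall (θBal F.L γ (c * b₀) p₀ J) U →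
      g Q U = heightDensity F γ hJK (histGood F ℰp (θBal F.L γ b₀ p₀) K J) U * r Q U)
    (hoff : ∀ Q, Q ∉ D → ∀ U, PlaqSmall (θBal F.L γ (c * b₀) p₀ J) U → r Q U = 0)
    (hr : ∀ (Q : Finset Λ) (U : GaugeField (F.P J) 0 (Matrix.specialUnitaryGroup (Fin 2) ℂ)), PlaqSmall (θBal F.L γ (c * b₀) p₀ J) U → r Q U =
      ∑ 𝒳 ∈ (Finset.univ : Finset (Finset (PBond (F.P J) 0))).powerset.filter (fun 𝒳 => IsCompatible polyInc 𝒳 ∧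
        (∀ l ∈ Q, ∃ X ∈ 𝒳, π l ∈ X) ∧ ∀ X ∈ 𝒳, Adm (Q.filter fun l => π l ∈ X) X),
        ∏ X ∈ 𝒳, ζ (Q.filter fun l => π l ∈ X) X U)
    (hloc : ∀ Q' X (U U' : GaugeField (F.P J) 0 (Matrix.specialUnitaryGroup (Fin 2) ℂ)), Adm Q' X → (∀ e ∈ X, U e = U' e) → ζ Q' X U = ζ Q' X U')
    (hdom : ∀ Q' X U, Adm Q' X → PlaqSmall (θBal F.L γ (c * b₀) p₀ J) U → |ζ Q' X U| ≤ ζbar Q' X)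
    (hζ0 : ∀ Q' X, Adm Q' X → 0 ≤ ζbar Q' X)
    (hsf : ∀ l, 0 ≤ sf l) (hζ : ∀ Q' X, Adm Q' X → ζbar Q' X ≤ (∏ l ∈ Q', sf l) * Real.exp (-(κmu * (size X : ℝ))))
    (hσ : ∀ X, (∃ Q', Adm Q' X) → ∑ l ∈ Finset.univ.filter (fun l => π l ∈ X), sf l ≤ Ψ J * (size X : ℝ))
    (hΨ : 0 ≤ Ψ J)
    (hμ : Ψ J * (s₀ : ℝ) + κ * ℓ₀ + (Real.log m + 2 * Real.log Δ) + Ψ J + 2 ≤ κmu) :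
    ∃ (cst : ℝ) (w : GaugeField (F.P J) 0 (Matrix.specialUnitaryGroup (Fin 2) ℂ) → Finset (PBond (F.P J) 0) → ℝ),
      (∃ (wbar a ℓ' : Finset (PBond (F.P J) 0) → ℝ),
        (∀ U, w U ∅ = 0) ∧
        (∀ (X : Finset (PBond (F.P J) 0)) (U U' : GaugeField (F.P J) 0 (Matrix.specialUnitaryGroup (Fin 2) ℂ)),
          (∀ e ∈ X, U e = U' e) → w U X = w U' X) ∧
        (∀ X, 0 ≤ a X) ∧ (∀ X, 0 ≤ ℓ' X) ∧
        (∀ U, U ∈ {U : GaugeField (F.P J) 0 (Matrix.specialUnitaryGroup (Fin 2) ℂ) | PlaqSmall (θBal F.L γ (c * b₀) p₀ J) U} →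
          ∀ X, |w U X| ≤ wbar X) ∧
        (∀ X : Finset (PBond (F.P J) 0), ∀ e ∈ X, ∀ e' ∈ X, (e.src.tdist e'.src : ℝ) ≤ ℓ' X) ∧
        (∀ X : Finset (PBond (F.P J) 0), ∑ X' ∈ Finset.univ.filter (fun X' => polyInc X' X),
            wbar X' * Real.exp (a X' + κ * ℓ' X') ≤ a X) ∧
        (∀ e : PBond (F.P J) 0, a {e} ≤ Ψ J)) ∧
      ∀ᵐ U ∂fieldMeasure (F.P J) 0 (Matrix.specialUnitaryGroup (Fin 2) ℂ), PlaqSmall (θBal F.L γ (c * b₀) p₀ J) U →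
        heightDensity F γ hJK Set.univ U = Real.exp cst * heightDensity F γ hJK (histGood F ℰp (θBal F.L γ b₀ p₀) K J) U *
          (polymerPartitionFunction polyInc (fun X : Finset (PBond (F.P J) 0) => ((w U X : ℝ) : ℂ)) Finset.univ).re := by
  classical
  -- the continuity rows of the generic knit are discharged VACUOUSLY at the discrete topology (they feed only its continuity output, which is dropped)
  letI : TopologicalSpace (Matrix.specialUnitaryGroup (Fin 2) ℂ) := ⊥
  haveI : DiscreteTopology (Matrix.specialUnitaryGroup (Fin 2) ℂ) := ⟨rfl⟩
  obtain ⟨cst, w, hKP, -, hid⟩ := aeGas_of_factorised_histories (fieldMeasure (F.P J) 0 (Matrix.specialUnitaryGroup (Fin 2) ℂ)) H hΔ h1Δ cell hm h1m hs₀ size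
      (fun e e' : PBond (F.P J) 0 => ((e.src.tdist e'.src : ℕ) : ℝ)) ℓ ℓ₀ hℓ0 hdiam
      {U : GaugeField (F.P J) 0 (Matrix.specialUnitaryGroup (Fin 2) ℂ) | PlaqSmall (θBal F.L γ (c * b₀) p₀ J) U} π Adm ζ ζbar sf (Ψ J) κmu κ
      (heightDensity F γ hJK Set.univ) (heightDensity F γ hJK (histGood F ℰp (θBal F.L γ b₀ p₀) K J)) D g r hAdm hℓ hsum hrat hoff hr
      (fun Q' X _ => continuous_of_discreteTopology.continuousOn) hloc hdom hζ0 hsf hζ hσ hΨ hκ hμ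
  exact ⟨cst, w, hKP, hid⟩

/-! ## §2 The bare socket -/

open Classical in
/-- ★★★ **THE BARE A.E. ∃-BODY AT ONE `(J, K)` FROM THE BARE ENGINE ROWS** — ✓`…SocketOfEngine.canIntBody_of_engine` WITHOUT (r1∘) and WITHOUT `hζc` (footprint map,
a.e. ratio identities, V-locality, majorant, energy, budget, rate — NO continuity), concluding the ∃-body of ⟨LFG^{ae,bare}∘⟩: same plugging of FILE 7∕8, (H+W) and the
off-deep vanishing, over `aeIntBareBody_of_factorised_histories`. [cite: Balaban1985UV3, (43)-(47) pp.266-267 and (67)-(71) pp.273-274; Balaban1989LargeFieldII, (1.84) p.386, (1.90)-(1.91) p.388 and (1.97)-(1.101) pp.389-390] -/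
theorem aeIntBareBody_of_engineBare (F : T3Family) {γ : ℝ} (hγ : 0 < γ) (hγ1 : γ ≤ 1) {b₀ : ℝ} (hb₀ : 0 < b₀) (p₀ : ℝ) {c : ℝ} (hc1 : c ≤ 1)
    {J K : ℕ} (hJK : J ≤ K) {κ : ℝ} (hκ : 0 ≤ κ) (Ψ : ℕ → ℝ) (hΨ : 0 ≤ Ψ J) (a : ℝ)
    -- the grain: cells = the `μ`-fold blocks `B^μ(y)` of the height-`J` lattice (Bałaban's `M`-cubes, `M = L^μ`; FILE 7)
    (μ : ℕ) (hμJ : μ ≤ F.m + J)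
    -- the located budget per block at `(J, K)` (FILE 8 `exists_located_budget_blocks`, uniform in the run)
    (hbud : ∀ Fc : Finset (Site (F.P J) μ),
      ∑ l ∈ Finset.univ.filter (fun l : LFLabel F K J =>
          iterBlockOf μ (siteShift (F.sitesPerDir_eq (m := F.m) (K := K) (j := l.1.val + (K - J - l.1.val)) (m' := F.m) (K' := J) (j' := 0)
            (by have := l.1.isLt; omega)) (blkIter (K - J - l.1.val) l.2.src)) ∈ Fc),
        (if l.1.val < K - J then smallFactor F.L γ b₀ p₀ a (K - l.1.val) else 0) ≤ Ψ J * (Fc.card : ℝ))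
    -- ═══ THE ENGINE ROWS ═══
    (Adm : Finset (LFLabel F K J) → Finset (PBond (F.P J) 0) → Prop)
    (hAdm : ∀ Q' X, Adm Q' X → Q'.Nonempty ∧
      (∀ l ∈ Q', l.1.val < K - J ∧
        (⟨siteShift (F.sitesPerDir_eq (m := F.m) (K := K) (j := l.1.val + (K - J - l.1.val)) (m' := F.m) (K' := J) (j' := 0)
            (by have := l.1.isLt; omega)) (blkIter (K - J - l.1.val) l.2.src), l.2.μ⟩ : PBond (F.P J) 0) ∈ X) ∧
      ∃ Fc : Finset (Site (F.P J) μ), ((touchingGraph (SiteTouch (P := F.P J) (j := μ))).induce (Fc : Set (Site (F.P J) μ))).Connected ∧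
        Fc.biUnion (fun y => Finset.univ.filter (fun b : PBond (F.P J) 0 => iterBlockOf μ b.src = y)) = X)
    (ζ : Finset (LFLabel F K J) → Finset (PBond (F.P J) 0) → GaugeField (F.P J) 0 (Matrix.specialUnitaryGroup (Fin 2) ℂ) → ℝ)
    (ζbar : Finset (LFLabel F K J) → Finset (PBond (F.P J) 0) → ℝ) (κmu : ℝ)
    (hrat : ∀ Q : Finset (LFLabel F K J), (∀ l ∈ Q, l.1.val < K - J) →
      ∀ᵐ U ∂fieldMeasure (F.P J) 0 (Matrix.specialUnitaryGroup (Fin 2) ℂ), PlaqSmall (θBal F.L γ (c * b₀) p₀ J) U →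
        heightDensity F γ hJK (histEvent F (θBal F.L γ b₀ p₀) K J Q) U =
          heightDensity F γ hJK (histGood F ℰp (θBal F.L γ b₀ p₀) K J) U *
            ∑ 𝒳 ∈ (Finset.univ : Finset (Finset (PBond (F.P J) 0))).powerset.filter (fun 𝒳 => IsCompatible polyInc 𝒳 ∧
                (∀ l ∈ Q, ∃ X ∈ 𝒳, (⟨siteShift (F.sitesPerDir_eq (m := F.m) (K := K) (j := l.1.val + (K - J - l.1.val)) (m' := F.m) (K' := J)
                    (j' := 0) (by have := l.1.isLt; omega)) (blkIter (K - J - l.1.val) l.2.src), l.2.μ⟩ : PBond (F.P J) 0) ∈ X) ∧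
                ∀ X ∈ 𝒳, Adm (Q.filter fun l => (⟨siteShift (F.sitesPerDir_eq (m := F.m) (K := K) (j := l.1.val + (K - J - l.1.val))
                    (m' := F.m) (K' := J) (j' := 0) (by have := l.1.isLt; omega)) (blkIter (K - J - l.1.val) l.2.src), l.2.μ⟩ : PBond (F.P J) 0) ∈ X) X),
              ∏ X ∈ 𝒳, ζ (Q.filter fun l => (⟨siteShift (F.sitesPerDir_eq (m := F.m) (K := K) (j := l.1.val + (K - J - l.1.val))
                  (m' := F.m) (K' := J) (j' := 0) (by have := l.1.isLt; omega)) (blkIter (K - J - l.1.val) l.2.src), l.2.μ⟩ : PBond (F.P J) 0) ∈ X) X U)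
    (hloc : ∀ Q' X (U U' : GaugeField (F.P J) 0 (Matrix.specialUnitaryGroup (Fin 2) ℂ)), Adm Q' X → (∀ e ∈ X, U e = U' e) → ζ Q' X U = ζ Q' X U')
    (hdom : ∀ Q' X U, Adm Q' X → PlaqSmall (θBal F.L γ (c * b₀) p₀ J) U → |ζ Q' X U| ≤ ζbar Q' X)
    (hζ0 : ∀ Q' X, Adm Q' X → 0 ≤ ζbar Q' X)
    (hζ : ∀ Q' X, Adm Q' X → ζbar Q' X ≤
      (∏ l ∈ Q', (if l.1.val < K - J then smallFactor F.L γ b₀ p₀ a (K - l.1.val) else 0)) *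
        Real.exp (-(κmu * ((X.image (fun b : PBond (F.P J) 0 => iterBlockOf μ b.src)).card : ℝ))))
    -- the ONE numeric rate row: tree decay per block ≥ entropy + pinned size + length (s₀ = 3L^{3μ}, ℓ₀ = 6L^μ, m = 1, Δ = 26)
    (hμ : Ψ J * (3 * ((F.L : ℝ) ^ 3) ^ μ) + κ * (6 * (F.L : ℝ) ^ μ) + 2 * Real.log 26 + Ψ J + 2 ≤ κmu) :
    ∃ (cst : ℝ) (w : GaugeField (F.P J) 0 (Matrix.specialUnitaryGroup (Fin 2) ℂ) → Finset (PBond (F.P J) 0) → ℝ),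
      (∃ (wbar a ℓ' : Finset (PBond (F.P J) 0) → ℝ),
        (∀ U, w U ∅ = 0) ∧
        (∀ (X : Finset (PBond (F.P J) 0)) (U U' : GaugeField (F.P J) 0 (Matrix.specialUnitaryGroup (Fin 2) ℂ)),
          (∀ e ∈ X, U e = U' e) → w U X = w U' X) ∧
        (∀ X, 0 ≤ a X) ∧ (∀ X, 0 ≤ ℓ' X) ∧
        (∀ U, U ∈ {U : GaugeField (F.P J) 0 (Matrix.specialUnitaryGroup (Fin 2) ℂ) | PlaqSmall (θBal F.L γ (c * b₀) p₀ J) U} →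
          ∀ X, |w U X| ≤ wbar X) ∧
        (∀ X : Finset (PBond (F.P J) 0), ∀ e ∈ X, ∀ e' ∈ X, (e.src.tdist e'.src : ℝ) ≤ ℓ' X) ∧
        (∀ X : Finset (PBond (F.P J) 0), ∑ X' ∈ Finset.univ.filter (fun X' => polyInc X' X),
            wbar X' * Real.exp (a X' + κ * ℓ' X') ≤ a X) ∧
        (∀ e : PBond (F.P J) 0, a {e} ≤ Ψ J)) ∧
      ∀ᵐ U ∂fieldMeasure (F.P J) 0 (Matrix.specialUnitaryGroup (Fin 2) ℂ), PlaqSmall (θBal F.L γ (c * b₀) p₀ J) U →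
        heightDensity F γ hJK Set.univ U = Real.exp cst * heightDensity F γ hJK (histGood F ℰp (θBal F.L γ b₀ p₀) K J) U *
          (polymerPartitionFunction polyInc (fun X : Finset (PBond (F.P J) 0) => ((w U X : ℝ) : ℂ)) Finset.univ).re := by
  have hd : 0 < (F.P J).d := by rw [T3Family.P_d]; norm_num
  have hμ' : μ ≤ (F.P J).m + (F.P J).K := hμJ
  -- FILE 7: the footprint geometry on the `μ`-blocks
  have hΔ : ∀ cc : Site (F.P J) μ, (touchingGraph (SiteTouch (P := F.P J) (j := μ))).degree cc ≤ 3 ^ (F.P J).d - 1 :=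
    fun cc => degree_touchingGraph_siteTouch_le_pred cc
  have h1Δ : 1 ≤ 3 ^ (F.P J).d - 1 := one_le_three_pow_sub_one hd
  have hAdmFc : ∀ Q' X, Adm Q' X → ∃ Fc : Finset (Site (F.P J) μ),
      ((touchingGraph (SiteTouch (P := F.P J) (j := μ))).induce (Fc : Set (Site (F.P J) μ))).Connected ∧
        Fc.biUnion (fun y => Finset.univ.filter (fun b : PBond (F.P J) 0 => iterBlockOf μ b.src = y)) = X :=
    fun Q' X h => (hAdm Q' X h).2.2
  have hℓ : ∀ X : Finset (PBond (F.P J) 0), (∃ Q', Adm Q' X) →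
      ((X.sup fun e => X.sup fun e' => e.src.tdist e'.src : ℕ) : ℝ) ≤
        (2 * ((F.P J).d : ℝ) * ((F.P J).L : ℝ) ^ μ) * (((X.image (fun b : PBond (F.P J) 0 => iterBlockOf μ b.src)).card : ℕ) : ℝ) :=
    fun X hX => supDiam_le_of_adm hd hμ' Adm hAdmFc X hX
  -- FILE 8: the budget row through FILE 7's size
  have hσ : ∀ X : Finset (PBond (F.P J) 0), (∃ Q', Adm Q' X) →
      ∑ l ∈ Finset.univ.filter (fun l : LFLabel F K J =>
          (⟨siteShift (F.sitesPerDir_eq (m := F.m) (K := K) (j := l.1.val + (K - J - l.1.val)) (m' := F.m) (K' := J) (j' := 0)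
            (by have := l.1.isLt; omega)) (blkIter (K - J - l.1.val) l.2.src), l.2.μ⟩ : PBond (F.P J) 0) ∈ X),
        (if l.1.val < K - J then smallFactor F.L γ b₀ p₀ a (K - l.1.val) else 0) ≤
        Ψ J * (((X.image (fun b : PBond (F.P J) 0 => iterBlockOf μ b.src)).card : ℕ) : ℝ) := by
    intro X hX
    obtain ⟨Q', hQ'⟩ := hX
    obtain ⟨Fc, -, rfl⟩ := hAdmFc Q' X hQ'
    rw [card_image_blk_biUnion_cell hd hμ']
    have hset : (Finset.univ.filter fun l : LFLabel F K J =>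
        (⟨siteShift (F.sitesPerDir_eq (m := F.m) (K := K) (j := l.1.val + (K - J - l.1.val)) (m' := F.m) (K' := J) (j' := 0)
            (by have := l.1.isLt; omega)) (blkIter (K - J - l.1.val) l.2.src), l.2.μ⟩ : PBond (F.P J) 0) ∈
          Fc.biUnion (fun y => Finset.univ.filter (fun b : PBond (F.P J) 0 => iterBlockOf μ b.src = y))) =
        Finset.univ.filter (fun l : LFLabel F K J =>
          iterBlockOf μ (siteShift (F.sitesPerDir_eq (m := F.m) (K := K) (j := l.1.val + (K - J - l.1.val)) (m' := F.m) (K' := J) (j' := 0)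
            (by have := l.1.isLt; omega)) (blkIter (K - J - l.1.val) l.2.src)) ∈ Fc) := by
      refine Finset.filter_congr fun l _ => ?_
      rw [mem_biUnion_cell_iff]
      exact Iff.rfl
    rw [hset]
    exact hbud Fc
  -- (H+W) on the shrunken window
  have hθ : θBal F.L γ (c * b₀) p₀ J ≤ θBal F.L γ b₀ p₀ J := T3InteriorExcision.θBal_mul_le (le_of_lt F.hL.2) hγ hγ1 hb₀ hc1 p₀ J
  have hsum : ∀ᵐ U ∂fieldMeasure (F.P J) 0 (Matrix.specialUnitaryGroup (Fin 2) ℂ), PlaqSmall (θBal F.L γ (c * b₀) p₀ J) U →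
      heightDensity F γ hJK Set.univ U = ∑ Q ∈ Finset.univ.filter (fun Q : Finset (LFLabel F K J) => ∀ e ∈ Q, e.1.val < K - J),
        heightDensity F γ hJK (histEvent F (θBal F.L γ b₀ p₀) K J Q) U := by
    filter_upwards [heightDensity_univ_ae_eq_sum_deep_on_window (F := F) (γ := γ) hγ.le hJK (θBal F.L γ b₀ p₀)] with U hU hUc
    exact hU (fun p => (hUc p).trans_le hθ)
  -- off the deep histories the factorised sum is empty
  have hdeep : ∀ Q' X, Adm Q' X → ∀ l ∈ Q',
      (⟨siteShift (F.sitesPerDir_eq (m := F.m) (K := K) (j := l.1.val + (K - J - l.1.val)) (m' := F.m) (K' := J) (j' := 0)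
          (by have := l.1.isLt; omega)) (blkIter (K - J - l.1.val) l.2.src), l.2.μ⟩ : PBond (F.P J) 0) ∈ X ∧ l.1.val < K - J :=
    fun Q' X h l hl => ⟨((hAdm Q' X h).2.1 l hl).2, ((hAdm Q' X h).2.1 l hl).1⟩
  -- small factors are nonnegative
  have hsf : ∀ l : LFLabel F K J, 0 ≤ (if l.1.val < K - J then smallFactor F.L γ b₀ p₀ a (K - l.1.val) else 0) := by
    intro l
    split_ifs
    · exact (smallFactor_pos _ _ _ _ _ _).le
    · exact le_rfl
  -- the rate row in the socket's letters
  have hrate : Ψ J * (((F.P J).d * ((F.P J).L ^ (F.P J).d) ^ μ : ℕ) : ℝ) + κ * (2 * ((F.P J).d : ℝ) * ((F.P J).L : ℝ) ^ μ) +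
      (Real.log ((1 : ℕ) : ℝ) + 2 * Real.log ((3 ^ (F.P J).d - 1 : ℕ) : ℝ)) + Ψ J + 2 ≤ κmu := by
    have h26 : ((3 ^ (F.P J).d - 1 : ℕ) : ℝ) = 26 := by rw [T3Family.P_d]; norm_num
    have hs₀ : (((F.P J).d * ((F.P J).L ^ (F.P J).d) ^ μ : ℕ) : ℝ) = 3 * ((F.L : ℝ) ^ 3) ^ μ := by
      rw [T3Family.P_d, show (F.P J).L = F.L from rfl]; push_cast; ring
    have hℓ₀ : 2 * ((F.P J).d : ℝ) * ((F.P J).L : ℝ) ^ μ = 6 * (F.L : ℝ) ^ μ := by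
      rw [T3Family.P_d, show (F.P J).L = F.L from rfl]; push_cast; ring
    rw [h26, hs₀, hℓ₀, Nat.cast_one, Real.log_one, zero_add]
    linarith
  exact aeIntBareBody_of_factorised_histories F b₀ p₀ c hJK hκ Ψ (touchingGraph (SiteTouch (P := F.P J) (j := μ))) hΔ h1Δ
    (fun y => Finset.univ.filter (fun b : PBond (F.P J) 0 => iterBlockOf μ b.src = y)) card_filter_mem_cell_le_one le_rfl (card_cell_le hμ')
    (fun X => (X.image (fun b : PBond (F.P J) 0 => iterBlockOf μ b.src)).card)
    (fun X => ((X.sup fun e => X.sup fun e' => e.src.tdist e'.src : ℕ) : ℝ)) (2 * ((F.P J).d : ℝ) * ((F.P J).L : ℝ) ^ μ)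
    (fun X => Nat.cast_nonneg _) (fun X e he e' he' => footprint_hdiam X e he e' he')
    (fun l : LFLabel F K J => (⟨siteShift (F.sitesPerDir_eq (m := F.m) (K := K) (j := l.1.val + (K - J - l.1.val)) (m' := F.m) (K' := J) (j' := 0)
      (by have := l.1.isLt; omega)) (blkIter (K - J - l.1.val) l.2.src), l.2.μ⟩ : PBond (F.P J) 0))
    Adm ζ ζbar (fun l => if l.1.val < K - J then smallFactor F.L γ b₀ p₀ a (K - l.1.val) else 0) κmu
    (Finset.univ.filter (fun Q : Finset (LFLabel F K J) => ∀ e ∈ Q, e.1.val < K - J))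
    (fun Q => heightDensity F γ hJK (histEvent F (θBal F.L γ b₀ p₀) K J Q)) _
    (fun Q' X h => ⟨(hAdm Q' X h).1, fun l hl => ((hAdm Q' X h).2.1 l hl).2, by
      obtain ⟨Fc, hc, hX⟩ := hAdmFc Q' X h
      exact ⟨Fc, hc, hX, by rw [← hX, card_image_blk_biUnion_cell hd hμ']⟩⟩)
    hℓ hsum
    (fun Q hQ => hrat Q (Finset.mem_filter.mp hQ).2)
    (fun Q hQ U _ => ratio_eq_zero_of_not_deep _ Adm (fun Q' X => ζ Q' X U) (fun l : LFLabel F K J => l.1.val < K - J) hdeep Q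
      (fun h => hQ (Finset.mem_filter.mpr ⟨Finset.mem_univ _, h⟩)))
    (fun Q U _ => rfl) hloc hdom hζ0 hsf hζ hσ hΨ hrate

end Summit.QuantumFields.YangMills.Theorems.FluctuationComparisonRegPrIntLLargeFieldGasBareKnit

end
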